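import Summits.CriticalPhenomena.PercolationContinuityZ3.Theorems.PercNearOneGluingNoHeavyPcintNawChainWindowCert
import Summits.CriticalPhenomena.PercolationContinuityZ3.Theorems.PercNearOneGluingNoHeavyPcintWinKernelTree
import Summits.CriticalPhenomena.PercolationContinuityZ3.Theorems.PercNearOneGluingNoHeavyPcintWinKernelNFP
import HarnessLib

/-!
# PCINT lane, kernel window certificates for kind `nawchain_cw` (B2c) — computable counts

Cell `prim-pcint`, seat `prim-pcint-2` (gen 3); memo `run/shared/lean/prim/pcint/REDUCTIONS.md` §B2c, INTERVAL-PLAN §16.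
Does NOT build on p205010.  On top of the generic kernel layers `…PcintWinKernel{,Fast,Cert,Sym,SymCert,NF,NFP,Tree}` (gen 2)
and the B2c window-certificate theorem `le_siteCriticalProb_zd_of_nawChainWindowCert` this file provides, for the B2c rule
with chain parameter `kc`:
* computable per-direction data on the one-pass site list (`incF`, `linkedF`, `detF`, `bonusF`, `payF`, `cornerDirF`) and
  the counts `uNF` / `ceNF`, with `uN = winUnitsTrue`, `ceN = winCoinTrue` (`uN_eq`, `ceN_eq`) and their invariance under
  the hyperoctahedral group;
* (in `…PcintWinKernelChainCert`) the integer weights, rows and the bound theorem `le_siteCriticalProb_of_checkScK`.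
-/

namespace Summit.CriticalPhenomena.PercolationContinuityZ3.Theorems.Pcint

open Finset Literature.Probability.Percolation Literature.Probability.LatticeModels

namespace WinK

variable {d m : ℕ}

/-! ### Computable per-direction data on a site list -/

section Comp

variable (d m kc : ℕ) (ps : List (List ℤ))

/-- The neighbour of the new site `P_{m+2}` in direction `e`. [folklore] -/
def nbrF (e : Fin d × Bool) : List ℤ := addL (nthP ps (m + 2)) (toL d e)

/-- Its visible earlier incidences `P_i ~ x_e`, `i ≤ m`. [folklore] -/
def incF (e : Fin d × Bool) : List ℕ := (List.range (m + 1)).filter fun i => adjF (nthP ps i) (nbrF d m ps e)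

/-- Linked: off the window and an incidence at gap `≤ kc`. [folklore] -/
def linkedF (e : Fin d × Bool) : Bool :=
  decide (nbrF d m ps e ∉ ps) && (incF d m ps e).any fun i => m + 2 ≤ i + kc

/-- Deterministic evidence: an incidence at gap `≥ 4`. [folklore] -/
def detF (e : Fin d × Bool) : Bool := (incF d m ps e).any fun i => i + 4 ≤ m + 2

/-- Bonus: the latest incidence `i₁ ≥ kc` is isolated (`[i₁ - kc, i₁)` free of incidences). [folklore] -/
def bonusF (e : Fin d × Bool) : Bool :=
  (incF d m ps e).any fun i => kc ≤ i && (incF d m ps e).all fun i' => i' == i || i' + kc < i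

/-- Payment of direction `e`: `0`, `1` or `2` units. [folklore] -/
def payF (e : Fin d × Bool) : ℕ := if linkedF d m kc ps e then (if bonusF d m kc ps e then 2 else 1) else 0

/-- Direction `e` points at the corner site `P_m + a`. [folklore] -/
def cornerDirF (a e : Fin d × Bool) : Bool := decide (nbrF d m ps e = cornerF d m ps a)

/-- Unconditional units of the step. [folklore] -/
def uNF : ℕ := ∑ e : Fin d × Bool, if detF d m ps e then payF d m kc ps e else 0

/-- Conditional (corner-coin) units of the step. [folklore] -/
def ceNF (a : Fin d × Bool) : ℕ :=
  ∑ e : Fin d × Bool, if !detF d m ps e && cornerDirF d m ps a e then payF d m kc ps e else 0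

end Comp

/-- Reference form of the unconditional units (site list of the window). [folklore] -/
def uN (kc : ℕ) (u : Fin (m + 1) → Fin d × Bool) (a : Fin d × Bool) : ℕ := uNF d m kc (sites u a)

/-- Reference form of the conditional units. [folklore] -/
def ceN (kc : ℕ) (u : Fin (m + 1) → Fin d × Bool) (a : Fin d × Bool) : ℕ := ceNF d m kc (sites u a) a

/-! ### Soundness: the computable data are the genuine ones -/

section Sound

variable (kc : ℕ) (u : Fin (m + 1) → Fin d × Bool) (a : Fin d × Bool)

/-- Length of the neighbour list. [folklore] -/
theorem length_nbrF (e : Fin d × Bool) : (nbrF d m (sites u a) e).length = d := by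
  rw [nbrF, nthP_sites u a le_rfl]; exact length_addL (length_posL u a _) (length_toL _)

/-- The neighbour list is the neighbour site. [folklore] -/
theorem toSite_nbrF (e : Fin d × Bool) : (toSite (nbrF d m (sites u a) e) : Site d) = winNbr u a e := by
  rw [nbrF, nthP_sites u a le_rfl, toSite_addL (length_posL u a _) (length_toL _), toSite_toL, winNbr,
    wordPos_eq_posL u a le_rfl]

/-- Computable incidences are the visible incidences. [folklore] -/
theorem mem_incF_iff (e : Fin d × Bool) (i : ℕ) :
    i ∈ incF d m (sites u a) e ↔ i ∈ visInc (m + 2) (wext u a) (m + 2) (winNbr u a e) := by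
  rw [incF, List.mem_filter, List.mem_range, mem_visInc, mem_incTimes, ← toSite_nbrF]
  constructor
  · rintro ⟨hi, hadj⟩
    rw [nthP_sites u a (by omega), adjF_eq_adjL (length_posL u a _) (length_nbrF u a e),
      ← adj_iff_adjL (length_posL u a _) (length_nbrF u a e), ← wordPos_eq_posL u a (by omega)] at hadj
    exact ⟨⟨by omega, hadj⟩, by omega, by omega⟩
  · rintro ⟨⟨-, hadj⟩, -, hi2⟩
    refine ⟨by omega, ?_⟩
    rw [nthP_sites u a (by omega), adjF_eq_adjL (length_posL u a _) (length_nbrF u a e),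
      ← adj_iff_adjL (length_posL u a _) (length_nbrF u a e), ← wordPos_eq_posL u a (by omega)]
    exact hadj

/-- Off the site list ↔ off the path of the extended window. [folklore] -/
theorem nbrF_notMem_iff (e : Fin d × Bool) :
    nbrF d m (sites u a) e ∉ sites u a ↔ winNbr u a e ∉ pathSites (wext u a) := by
  rw [← toSite_nbrF, mem_sites, mem_pathSites]
  constructor
  · rintro h ⟨j, hj, hje⟩
    refine h ⟨j, by omega, ?_⟩
    rw [wordPos_eq_posL u a (by omega)] at hje
    exact toSite_inj (length_posL u a j) (length_nbrF u a e) hje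
  · rintro h ⟨j, hj, hje⟩
    exact h ⟨j, by omega, by rw [wordPos_eq_posL u a (by omega), hje]⟩

/-- `linkedF` is `IsLinkedW`. [folklore] -/
theorem linkedF_iff (e : Fin d × Bool) :
    linkedF d m kc (sites u a) e = true ↔ IsLinkedW (m + 2) kc (wext u a) (m + 2) (winNbr u a e) := by
  rw [linkedF, Bool.and_eq_true, decide_eq_true_eq, List.any_eq_true, nbrF_notMem_iff, IsLinkedW]
  have hadj : (zdGraph d).Adj (wordPos (wext u a) (m + 2)) (winNbr u a e) := by
    rw [zdGraph_adj_iff_stepVec]; exact ⟨e, rfl⟩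
  constructor
  · rintro ⟨hoff, i, hi, hikc⟩
    exact ⟨hadj, hoff, i, (mem_incF_iff u a e i).1 hi, by simpa using hikc⟩
  · rintro ⟨-, hoff, i, hi, hikc⟩
    exact ⟨hoff, i, (mem_incF_iff u a e i).2 hi, by simpa using hikc⟩

/-- `detF` is `IsWinDet`. [folklore] -/
theorem detF_iff (e : Fin d × Bool) : detF d m (sites u a) e = true ↔ IsWinDet u a e := by
  rw [detF, List.any_eq_true, IsWinDet, IsDetW]
  constructor
  · rintro ⟨i, hi, h4⟩; exact ⟨i, (mem_incF_iff u a e i).1 hi, by simpa using h4⟩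
  · rintro ⟨i, hi, h4⟩; exact ⟨i, (mem_incF_iff u a e i).2 hi, by simpa using h4⟩

/-- `bonusF` is `IsBonusW`. [folklore] -/
theorem bonusF_iff (e : Fin d × Bool) :
    bonusF d m kc (sites u a) e = true ↔ IsBonusW (m + 2) kc (wext u a) (m + 2) (winNbr u a e) := by
  rw [bonusF, List.any_eq_true, IsBonusW]
  constructor
  · rintro ⟨i, hi, h⟩
    rw [Bool.and_eq_true, decide_eq_true_eq, List.all_eq_true] at h
    refine ⟨i, (mem_incF_iff u a e i).1 hi, by omega, fun i' hi' hne => ?_⟩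
    have := h.2 i' ((mem_incF_iff u a e i').2 hi')
    rw [Bool.or_eq_true, beq_iff_eq, decide_eq_true_eq] at this
    exact this.resolve_left hne
  · rintro ⟨i, hi, hK, hiso⟩
    refine ⟨i, (mem_incF_iff u a e i).2 hi, ?_⟩
    rw [Bool.and_eq_true, decide_eq_true_eq, List.all_eq_true]
    refine ⟨by omega, fun i' hi' => ?_⟩
    rw [Bool.or_eq_true, beq_iff_eq, decide_eq_true_eq]
    by_cases h : i' = i
    · exact Or.inl h
    · exact Or.inr (hiso i' ((mem_incF_iff u a e i').1 hi') h)

/-- `payF` is `winPay`. [folklore] -/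
theorem payF_eq (e : Fin d × Bool) : payF d m kc (sites u a) e = winPay kc u a e := by
  classical
  unfold payF winPay payW
  by_cases hl : IsLinkedW (m + 2) kc (wext u a) (m + 2) (winNbr u a e)
  · rw [if_pos ((linkedF_iff kc u a e).2 hl), if_pos hl]
    by_cases hb : IsBonusW (m + 2) kc (wext u a) (m + 2) (winNbr u a e)
    · rw [if_pos ((bonusF_iff kc u a e).2 hb), if_pos hb]
    · rw [if_neg hb, if_neg (fun h => hb ((bonusF_iff kc u a e).1 h))]
  · rw [if_neg hl, if_neg (fun h => hl ((linkedF_iff kc u a e).1 h))]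

/-- `cornerDirF` is `IsCornerDir`. [folklore] -/
theorem cornerDirF_iff (e : Fin d × Bool) : cornerDirF d m (sites u a) a e = true ↔ IsCornerDir u a e := by
  have hc : cornerF d m (sites u a) a = cornerL u a := by rw [cornerF, cornerL, nthP_sites u a (by omega)]
  have hlen : (cornerL u a).length = d := length_addL (length_posL u a _) (length_toL _)
  have hcs : (toSite (cornerL u a) : Site d) = wordPos (wext u a) m + stepVec a := by
    rw [cornerL, toSite_addL (length_posL u a _) (length_toL _), toSite_toL, wordPos_eq_posL u a (by omega)]
  rw [cornerDirF, decide_eq_true_eq, hc, IsCornerDir, ← toSite_nbrF, ← hcs]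
  constructor
  · intro h; rw [h]
  · intro h; exact toSite_inj (length_nbrF u a e) hlen h

/-- **The computable unconditional units are the genuine ones.** [folklore] -/
theorem uN_eq : uN kc u a = winUnitsTrue kc u a := by
  classical
  unfold uN uNF winUnitsTrue
  refine Finset.sum_congr rfl fun e _ => ?_
  rw [payF_eq]
  by_cases h : IsWinDet u a e
  · rw [if_pos h, if_pos ((detF_iff u a e).2 h)]
  · rw [if_neg h, if_neg (fun h' => h ((detF_iff u a e).1 h'))]

/-- **The computable conditional units are the genuine ones.** [folklore] -/
theorem ceN_eq : ceN kc u a = winCoinTrue kc u a := by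
  classical
  unfold ceN ceNF winCoinTrue
  refine Finset.sum_congr rfl fun e _ => ?_
  rw [payF_eq]
  have hc : ((!detF d m (sites u a) e && cornerDirF d m (sites u a) a e) = true) ↔
      (¬ IsWinDet u a e ∧ IsCornerDir u a e) := by
    rw [Bool.and_eq_true, Bool.not_eq_true', Bool.eq_false_iff, ne_eq, detF_iff, cornerDirF_iff]
  by_cases h : ¬ IsWinDet u a e ∧ IsCornerDir u a e
  · rw [if_pos h, if_pos (hc.2 h)]
  · rw [if_neg h, if_neg (mt hc.1 h)]

/-- The conditional units are at most `2` (at most one direction points at the corner site). [folklore] -/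
theorem winCoinTrue_le_two : winCoinTrue kc u a ≤ 2 := by
  classical
  unfold winCoinTrue
  calc ∑ e : Fin d × Bool, (if ¬ IsWinDet u a e ∧ IsCornerDir u a e then winPay kc u a e else 0)
      ≤ ∑ e : Fin d × Bool, (if IsCornerDir u a e then 2 else 0) := sum_le_sum fun e _ => by
        split_ifs with h1 h2 h2
        · exact payW_le_two _ _ _ _ _
        · exact absurd h1.2 h2
        · exact Nat.zero_le _
        · exact le_rfl
    _ = 2 * ((univ : Finset (Fin d × Bool)).filter fun e => IsCornerDir u a e).card := by
        rw [← sum_filter, sum_const, smul_eq_mul, mul_comm]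
    _ ≤ 2 * 1 := by
        refine Nat.mul_le_mul_left 2 (card_le_one.2 fun e he e' he' => ?_)
        have h1 : winNbr u a e = winNbr u a e' := by
          rw [(mem_filter.1 he).2, (mem_filter.1 he').2]
        unfold winNbr at h1
        obtain ⟨i, b⟩ := e
        obtain ⟨i', b'⟩ := e'
        have h2 : stepVec (i, b) = stepVec (i', b') := add_left_cancel h1
        have hi : i = i' := by
          by_contra hne
          have h3 := congrFun h2 i
          cases b <;> cases b' <;> simp [stepVec, Pi.single_eq_of_ne hne] at h3
        subst hi
        have h3 := congrFun h2 i
        cases b <;> cases b' <;> simp [stepVec] at h3 ⊢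
    _ = 2 := rfl

/-- `ceN ≤ 2`. [folklore] -/
theorem ceN_le_two : ceN kc u a ≤ 2 := by rw [ceN_eq]; exact winCoinTrue_le_two kc u a

/-- `uN ≤ 4d` (each direction pays at most `2` units). [folklore] -/
theorem uN_le : uN kc u a ≤ 4 * d := by
  classical
  rw [uN_eq]
  unfold winUnitsTrue
  calc ∑ e : Fin d × Bool, (if IsWinDet u a e then winPay kc u a e else 0) ≤ ∑ _e : Fin d × Bool, 2 :=
        sum_le_sum fun e _ => by
          split_ifs
          · exact payW_le_two _ _ _ _ _
          · exact Nat.zero_le _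
    _ = 4 * d := by
        rw [sum_const, card_univ, Fintype.card_prod, Fintype.card_fin, Fintype.card_bool, smul_eq_mul]; ring

end Sound

/-! ### Invariance under the hyperoctahedral group -/

section Invariance

variable (g : SPerm d)

/-- Incidence times are invariant. [folklore] -/
theorem incTimes_actW {n : ℕ} (w : Fin n → Fin d × Bool) (x : Site d) :
    incTimes (actW g w) (toS g x) = incTimes w x := by
  ext t
  rw [mem_incTimes, mem_incTimes, wordPos_actW, adj_toS_iff]

/-- Path sites transform by the isometry. [folklore] -/
theorem mem_pathSites_actW_iff {n : ℕ} (w : Fin n → Fin d × Bool) (x : Site d) :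
    toS g x ∈ pathSites (actW g w) ↔ x ∈ pathSites w := by
  rw [mem_pathSites, mem_pathSites]
  simp only [wordPos_actW, (toS g).injective.eq_iff]

/-- Visible incidences are invariant. [folklore] -/
theorem visInc_actW (K : ℕ) {n : ℕ} (w : Fin n → Fin d × Bool) (T : ℕ) (x : Site d) :
    visInc K (actW g w) T (toS g x) = visInc K w T x := by
  rw [visInc, visInc, incTimes_actW]

/-- Payments are invariant. [folklore] -/
theorem payW_actW (K kc : ℕ) {n : ℕ} (w : Fin n → Fin d × Bool) (T : ℕ) (x : Site d) :
    payW K kc (actW g w) T (toS g x) = payW K kc w T x := by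
  classical
  have hl : IsLinkedW K kc (actW g w) T (toS g x) ↔ IsLinkedW K kc w T x := by
    unfold IsLinkedW
    rw [wordPos_actW, adj_toS_iff, mem_pathSites_actW_iff, visInc_actW]
  have hb : IsBonusW K kc (actW g w) T (toS g x) ↔ IsBonusW K kc w T x := by
    unfold IsBonusW; rw [visInc_actW]
  unfold payW
  simp only [hl, hb]

/-- Deterministic evidence is invariant. [folklore] -/
theorem isDetW_actW_iff (K : ℕ) {n : ℕ} (w : Fin n → Fin d × Bool) (T : ℕ) (x : Site d) :
    IsDetW K (actW g w) T (toS g x) ↔ IsDetW K w T x := by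
  unfold IsDetW; rw [visInc_actW]

/-- The neighbour sites transform by the isometry. [folklore] -/
theorem winNbr_actW (u : Fin (m + 1) → Fin d × Bool) (a e : Fin d × Bool) :
    winNbr (actW g u) (actStep g a) (actStep g e) = toS g (winNbr u a e) := by
  rw [winNbr, winNbr, wext_actW, wordPos_actW, toS_add, toS_stepVec]

/-- The corner direction is invariant. [folklore] -/
theorem isCornerDir_actW_iff (u : Fin (m + 1) → Fin d × Bool) (a e : Fin d × Bool) :
    IsCornerDir (actW g u) (actStep g a) (actStep g e) ↔ IsCornerDir u a e := by
  unfold IsCornerDir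
  rw [winNbr_actW, wext_actW, wordPos_actW, ← toS_stepVec, ← toS_add, (toS g).injective.eq_iff]

/-- The genuine unconditional units are invariant. [folklore] -/
theorem winUnitsTrue_actW (kc : ℕ) (u : Fin (m + 1) → Fin d × Bool) (a : Fin d × Bool) :
    winUnitsTrue kc (actW g u) (actStep g a) = winUnitsTrue kc u a := by
  classical
  unfold winUnitsTrue
  rw [← Fintype.sum_equiv (actStepEquiv g)
    (fun e => if IsWinDet (actW g u) (actStep g a) (actStep g e) then winPay kc (actW g u) (actStep g a) (actStep g e) else 0)
    (fun e => if IsWinDet (actW g u) (actStep g a) e then winPay kc (actW g u) (actStep g a) e else 0) (fun _ => rfl)]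
  refine Fintype.sum_congr _ _ fun e => ?_
  have h1 : IsWinDet (actW g u) (actStep g a) (actStep g e) ↔ IsWinDet u a e := by
    unfold IsWinDet; rw [winNbr_actW, wext_actW, isDetW_actW_iff]
  have h2 : winPay kc (actW g u) (actStep g a) (actStep g e) = winPay kc u a e := by
    unfold winPay; rw [winNbr_actW, wext_actW, payW_actW]
  simp only [h1, h2]

/-- The genuine conditional units are invariant. [folklore] -/
theorem winCoinTrue_actW (kc : ℕ) (u : Fin (m + 1) → Fin d × Bool) (a : Fin d × Bool) :
    winCoinTrue kc (actW g u) (actStep g a) = winCoinTrue kc u a := by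
  classical
  unfold winCoinTrue
  rw [← Fintype.sum_equiv (actStepEquiv g)
    (fun e => if ¬ IsWinDet (actW g u) (actStep g a) (actStep g e) ∧ IsCornerDir (actW g u) (actStep g a) (actStep g e)
      then winPay kc (actW g u) (actStep g a) (actStep g e) else 0)
    (fun e => if ¬ IsWinDet (actW g u) (actStep g a) e ∧ IsCornerDir (actW g u) (actStep g a) e
      then winPay kc (actW g u) (actStep g a) e else 0) (fun _ => rfl)]
  refine Fintype.sum_congr _ _ fun e => ?_
  have h1 : IsWinDet (actW g u) (actStep g a) (actStep g e) ↔ IsWinDet u a e := by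
    unfold IsWinDet; rw [winNbr_actW, wext_actW, isDetW_actW_iff]
  have h2 : winPay kc (actW g u) (actStep g a) (actStep g e) = winPay kc u a e := by
    unfold winPay; rw [winNbr_actW, wext_actW, payW_actW]
  simp only [h1, h2, isCornerDir_actW_iff]

/-- `uN` is invariant. [folklore] -/
theorem uN_actW (kc : ℕ) (u : Fin (m + 1) → Fin d × Bool) (a : Fin d × Bool) :
    uN kc (actW g u) (actStep g a) = uN kc u a := by
  rw [uN_eq, uN_eq, winUnitsTrue_actW]

/-- `ceN` is invariant. [folklore] -/
theorem ceN_actW (kc : ℕ) (u : Fin (m + 1) → Fin d × Bool) (a : Fin d × Bool) :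
    ceN kc (actW g u) (actStep g a) = ceN kc u a := by
  rw [ceN_eq, ceN_eq, winCoinTrue_actW]

end Invariance

end WinK

end Summit.CriticalPhenomena.PercolationContinuityZ3.Theorems.Pcint
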